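import Literature.AlgebraicGeometry.Resolution.RegularDerivationQuotient
import Literature.AlgebraicGeometry.Resolution.AdicCompletionRegular
import Literature.AlgebraicGeometry.Resolution.DerivativeIdealsLocalization
import Mathlib.RingTheory.AdjoinRoot
import Mathlib.Algebra.CharP.Lemmas
import Mathlib.Algebra.CharP.Algebra
import Mathlib.Algebra.Algebra.ZMod
import Mathlib.Algebra.Field.ZMod
import HarnessLib

/-!
# `p`-th roots of a radicand with invertible derivative: the order `A[Z]/(Z^p - θ)` is a regular
# local ring (Stacks 07PG over a regular LOCAL ring of characteristic `p`)

Topic: `Literature/AlgebraicGeometry/Resolution`. Local form of The Stacks Project, Tag 07PG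
("Let `R` be a regular ring and `f ∈ R`. Assume there exists a derivation `D : R → R` such that
`D(f)` is a unit of `R`. Then `R[z]/(zⁿ - f)` is regular for any integer `n ≥ 1`"; tree:
`isRegularRing_adjoinRoot_X_pow_sub_C_of_derivation`, `RegularDerivationQuotient.lean`) for a
regular LOCAL ring `A` of prime characteristic `p` and `n = p`: then `A[Z]/(Z^p - θ)` is moreover
LOCAL (every `p`-th power lies in `A`, so all maximal ideals lie over `𝔪_A` and coincide), hence
a regular local ring. With `Der(A) ∋ ∂ᵢ` dual to a regular system of parameters
(`DualDerivationsPrimeField.lean`) this decides the regularity of the normalisation of `A` in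
`K(θ^{1/p})` for MONOMIAL radicands `θ = w · ∏ uᵢ^{aᵢ}` at the primes missing the charged
coordinates (`isRegularLocalRing_adjoinRoot_localization_of_monomial`). Everything is PROVED:

* (tree, `AdicCompletionRegular.lean`: `isRegularRing_of_isRegularLocalRing` — Serre, Matsumura
  Thm. 19.3: a regular local ring is a regular ring;)
* `pow_char_mem_range_adjoinRoot`, `isLocalRing_adjoinRoot_X_pow_sub_C_of_charP` — in
  characteristic `p`, `A[Z]/(Z^p - θ)` over a local `A` is local;
* `isRegularLocalRing_adjoinRoot_X_pow_sub_C_of_derivation` — **`A` regular local of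
  characteristic `p`, `D ∈ Der(A)` with `D θ ∈ Aˣ` ⇒ `A[Z]/(Z^p - θ)` regular local**;
* `isRegularLocalRing_adjoinRoot_localization_of_monomial` — for `θ = w · u^a · m` (`w ∈ Aˣ`,
  `p ∤ a`, `∂u = 1`, `∂m = 0` for some `∂ ∈ Der(A)`, e.g. `m` a monomial in the other members of
  a regular system of parameters) and a prime `𝔮 ∌ u, m`: `A_𝔮[Z]/(Z^p - θ)` is regular local
  (`∂θ = u^{a-1} m (a w + u ∂w)` becomes a unit in `A_𝔮`; derivations extend to localisations).

## Sources

* The Stacks Project, Tag 07PG (Lemma 15.49.4), Tag 07PF. [StacksProject]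
* H. Matsumura, *Commutative Ring Theory*, CUP 1986, Thm. 19.3 (Serre). [Matsumura1987]
-/

noncomputable section

open IsLocalRing Polynomial

namespace Literature.AlgebraicGeometry.Resolution

universe u

/-! ## `A[Z]/(Z^p - θ)` is local in characteristic `p` -/

section Local

variable {A : Type u} [CommRing A] (p : ℕ) [Fact p.Prime] [CharP A p] (θ : A)

/-- In characteristic `p`, every `p`-th power in `A[Z]/(Z^p - θ)` comes from `A`:
`(Σ cᵢ zⁱ)^p = Σ cᵢ^p θⁱ`. [folklore] -/
theorem pow_char_mem_range_adjoinRoot (z : AdjoinRoot ((X : A[X]) ^ p - C θ)) :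
    ∃ c : A, z ^ p = AdjoinRoot.of _ c := by
  obtain ⟨g, rfl⟩ := AdjoinRoot.mk_surjective z
  have hroot : AdjoinRoot.root ((X : A[X]) ^ p - C θ) ^ p = AdjoinRoot.of _ θ := by
    have := AdjoinRoot.eval₂_root ((X : A[X]) ^ p - C θ)
    rwa [eval₂_sub, eval₂_X_pow, eval₂_C, sub_eq_zero] at this
  refine ⟨∑ i ∈ g.support, g.coeff i ^ p * θ ^ i, ?_⟩
  -- Frobenius in `A[X]`: `g^p = Σ cᵢ^p X^{p i}`
  have hg : g ^ p = ∑ i ∈ g.support, C (g.coeff i ^ p) * X ^ (p * i) := by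
    conv_lhs => rw [g.as_sum_support_C_mul_X_pow, sum_pow_char]
    refine Finset.sum_congr rfl fun i _ => ?_
    rw [mul_pow, ← C_pow, ← pow_mul, mul_comm i p]
  rw [← map_pow, hg, map_sum, map_sum]
  refine Finset.sum_congr rfl fun i _ => ?_
  simp only [map_mul, map_pow, AdjoinRoot.mk_C, AdjoinRoot.mk_X, pow_mul, hroot]

variable [IsLocalRing A]

/-- **`A[Z]/(Z^p - θ)` over a local ring `A` of characteristic `p` is local**: it is integral over
`A`, so its maximal ideals lie over `𝔪_A`, and `x ∈ 𝔫 ⇒ x^p ∈ 𝔫 ∩ A = 𝔪_A ⊆ 𝔫' ⇒ x ∈ 𝔫'` for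
any two of them. [folklore] -/
theorem isLocalRing_adjoinRoot_X_pow_sub_C_of_charP :
    IsLocalRing (AdjoinRoot ((X : A[X]) ^ p - C θ)) := by
  -- adapted from `stub_kummerOrderStructure` (locality of the Kummer order), Summits tree
  set f : A[X] := (X : A[X]) ^ p - C θ with hf
  have hmon : f.Monic := monic_X_pow_sub_C θ (Fact.out : p.Prime).ne_zero
  haveI : Module.Finite A (AdjoinRoot f) := hmon.finite_adjoinRoot
  haveI : Module.Free A (AdjoinRoot f) := hmon.free_adjoinRoot
  haveI : Algebra.IsIntegral A (AdjoinRoot f) := inferInstance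
  -- nontriviality: `A[Z]/(f)` is free of rank `p ≥ 1`
  haveI : Nontrivial (AdjoinRoot f) := by
    have hrank : Module.finrank A (AdjoinRoot f) = p := by
      rw [(AdjoinRoot.powerBasis' hmon).finrank, AdjoinRoot.powerBasis'_dim, hf,
        natDegree_X_pow_sub_C]
    exact Module.nontrivial_of_finrank_pos (R := A) (by rw [hrank]; exact (Fact.out : p.Prime).pos)
  have key : ∀ I J : Ideal (AdjoinRoot f), I.IsMaximal → J.IsMaximal → I ≤ J := by
    intro I J hI hJ x hx
    obtain ⟨c, hc⟩ := pow_char_mem_range_adjoinRoot p θ x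
    have hcI : c ∈ I.comap (algebraMap A (AdjoinRoot f)) := by
      rw [Ideal.mem_comap]
      change AdjoinRoot.of f c ∈ I
      rw [← hc]
      exact I.pow_mem_of_mem hx p (Fact.out : p.Prime).pos
    have hIc : I.comap (algebraMap A (AdjoinRoot f)) ≤ maximalIdeal A :=
      IsLocalRing.le_maximalIdeal (Ideal.comap_ne_top _ hI.ne_top)
    have hJc : J.comap (algebraMap A (AdjoinRoot f)) = maximalIdeal A := by
      haveI := hJ
      exact IsLocalRing.eq_maximalIdeal
        (Ideal.isMaximal_comap_of_isIntegral_of_isMaximal (R := A) J)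
    have hcJ : c ∈ J.comap (algebraMap A (AdjoinRoot f)) := hJc ▸ hIc hcI
    rw [Ideal.mem_comap] at hcJ
    change AdjoinRoot.of f c ∈ J at hcJ
    rw [← hc] at hcJ
    exact hJ.isPrime.mem_of_pow_mem p hcJ
  obtain ⟨M, hM⟩ := Ideal.exists_maximal (AdjoinRoot f)
  exact IsLocalRing.of_unique_max_ideal
    ⟨M, hM, fun M' hM' => hM'.eq_of_le hM.ne_top (key M' M hM' hM)⟩

end Local

/-! ## Stacks 07PG over a regular local ring -/

/-- **`A` regular local of characteristic `p`, `D θ` a unit for some derivation `D` of `A` ⇒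
`A[Z]/(Z^p - θ)` is a regular local ring** (Stacks 07PG gives a regular ring; it is local by
`isLocalRing_adjoinRoot_X_pow_sub_C_of_charP`). [cite: StacksProject, Tag 07PG] -/
theorem isRegularLocalRing_adjoinRoot_X_pow_sub_C_of_derivation {A : Type u} [CommRing A]
    [IsRegularLocalRing A] (p : ℕ) [Fact p.Prime] [CharP A p] (D : Derivation ℤ A A) (θ : A)
    (hD : IsUnit (D θ)) : IsRegularLocalRing (AdjoinRoot ((X : A[X]) ^ p - C θ)) := by
  haveI := isRegularRing_of_isRegularLocalRing A
  haveI : IsRegularRing (AdjoinRoot ((X : A[X]) ^ p - C θ)) :=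
    isRegularRing_adjoinRoot_X_pow_sub_C_of_derivation D θ hD p
  haveI := isLocalRing_adjoinRoot_X_pow_sub_C_of_charP p θ
  exact IsRegularLocalRing.of_isRegularRing_of_isLocalRing _

/-! ## Monomial radicands at primes missing the charged coordinates -/

/-- The derivative of a monomial radicand `θ = w · u^a · m` along `∂` with `∂u = 1`, `∂m = 0`:
`∂θ = u^{a-1} · m · (a w + u ∂w)` (`a ≥ 1`). [folklore] -/
theorem derivation_monomial_radicand {A : Type u} [CommRing A] (D : Derivation ℤ A A)
    (w u m : A) (a : ℕ) (ha : a ≠ 0) (hu : D u = 1) (hm : D m = 0) :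
    D (w * u ^ a * m) = u ^ (a - 1) * m * ((a : A) * w + u * D w) := by
  obtain ⟨b, rfl⟩ := Nat.exists_eq_succ_of_ne_zero ha
  rw [Derivation.leibniz, Derivation.leibniz, Derivation.leibniz_pow, hu, hm, smul_zero, zero_add,
    Nat.succ_sub_one]
  simp only [smul_eq_mul, nsmul_eq_mul, Nat.succ_eq_add_one, pow_succ]
  push_cast
  ring

/-- **Regularity of `A_𝔮[Z]/(Z^p - θ)` for a monomial radicand off its charged coordinate.**
Let `A` be a regular local ring of characteristic `p`, `∂ ∈ Der(A)`, and `θ = w · u^a · m` with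
`w ∈ Aˣ`, `p ∤ a`, `∂u = 1`, `∂m = 0`, `u ∈ 𝔪_A`. For a prime `𝔮` with `u, m ∉ 𝔮` and a
localisation `R = A_𝔮`, the ring `R[Z]/(Z^p - θ)` is a regular local ring: `∂` extends to `R`
and `∂θ = u^{a-1} m (a w + u ∂w)` is a unit there (`a w ∈ Aˣ`, `u ∂w ∈ 𝔪_A`).
[cite: StacksProject, Tag 07PG] -/
theorem isRegularLocalRing_adjoinRoot_localization_of_monomial {A : Type u} [CommRing A]
    [IsRegularLocalRing A] (p : ℕ) [Fact p.Prime] [CharP A p] (D : Derivation ℤ A A)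
    (w u m : A) (hw : IsUnit w) (huM : u ∈ maximalIdeal A) (a : ℕ) (ha : ¬ p ∣ a)
    (hu : D u = 1) (hm : D m = 0) (q : Ideal A) [q.IsPrime] (huq : u ∉ q) (hmq : m ∉ q)
    (R : Type u) [CommRing R] [Algebra A R] [IsLocalization.AtPrime R q] :
    IsRegularLocalRing (AdjoinRoot ((X : R[X]) ^ p - C (algebraMap A R (w * u ^ a * m)))) := by
  haveI : IsDomain A := isDomain_of_isRegularLocalRing A
  haveI : IsLocalRing R := IsLocalization.AtPrime.isLocalRing R q
  -- `R` is a regular local ring of characteristic `p`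
  haveI := isRegularLocalRing_localization_atPrime A q
  haveI : IsRegularLocalRing R :=
    IsRegularLocalRing.of_ringEquiv (IsLocalization.algEquiv q.primeCompl
      (Localization.AtPrime q) R).toRingEquiv
  have hinj : Function.Injective (algebraMap A R) :=
    IsLocalization.injective R q.primeCompl_le_nonZeroDivisors
  haveI : CharP R p := charP_of_injective_algebraMap hinj p
  -- extend `D` to `R`
  obtain ⟨D', hD'⟩ := exists_derivation_extend_of_isLocalization ℤ R q.primeCompl D
  refine isRegularLocalRing_adjoinRoot_X_pow_sub_C_of_derivation p D' _ ?_
  rw [hD', derivation_monomial_radicand D w u m a (fun h => ha (h ▸ dvd_zero p)) hu hm]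
  -- `u^{a-1} m (a w + u ∂w)` is a unit in `R`
  have h1 : IsUnit (algebraMap A R u) :=
    IsLocalization.map_units R (⟨u, huq⟩ : q.primeCompl)
  have h2 : IsUnit (algebraMap A R m) :=
    IsLocalization.map_units R (⟨m, hmq⟩ : q.primeCompl)
  have h3 : IsUnit ((a : A) * w + u * D w) := by
    -- `a` is a unit of the `𝔽_p`-algebra `A` (`p ∤ a`), and `u ∂w ∈ 𝔪_A`
    have hau : IsUnit (a : A) := by
      letI : Algebra (ZMod p) A := ZMod.algebra A p
      have h0 : ((a : ZMod p)) ≠ 0 := fun h => ha ((ZMod.natCast_eq_zero_iff a p).mp h)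
      have := (isUnit_iff_ne_zero.mpr h0).map (algebraMap (ZMod p) A)
      rwa [map_natCast] at this
    by_contra hnu
    have hmem : (a : A) * w + u * D w ∈ maximalIdeal A := (mem_maximalIdeal _).mpr hnu
    have hmem' : u * D w ∈ maximalIdeal A := Ideal.mul_mem_right _ _ huM
    have haw : (a : A) * w ∈ maximalIdeal A := by
      have := Ideal.sub_mem _ hmem hmem'
      rwa [add_sub_cancel_right] at this
    exact (mem_maximalIdeal _).mp haw (hau.mul hw)
  rw [map_mul, map_mul, map_pow]
  exact ((h1.pow _).mul h2).mul (h3.map _)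

end Literature.AlgebraicGeometry.Resolution

end
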